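import Literature.NumberTheory.Transcendental.KZLogCalculusProofs

/-!
# `SectorToKernel` (stmt-KontsevichZagierPeriods-10813), line `effective-cube-surjection`: stub B,
# affine straightening of an OPEN band

Crux `FurushoPentagon.SectorToKernel`, line `effective-cube-surjection`, stub B `stub_affineOpenBand` of
the lead's skeleton v6. Over an open `ℚ`-semialgebraic base `G ⊆ ℝᴹ` let `α`, `β` be `ℚ`-semialgebraic and
differentiable on `G` with `β > 0`. For every integral representation `r'` on the OPEN band
`{(y, s) | y ∈ G, α y < s < α y + β y}` there is a representation `r` on the open straight band
`G × (0, 1)` with integrand LITERALLY `r (y, t) = r' (y, α y + β y t) · β y`, and `[r] − [r'] ∈ KZ.relations`: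
one instance of Kontsevich–Zagier's rule (2) along `Φ (y, t) = (y, α y + β y t)` (a `ℚ`-semialgebraic map,
injective, differentiable with Jacobian determinant `β y` by `LinearMap.det_of_snoc_init`), exactly as in
the tree's closed-band version `KZ.of_sub_of_mem_relations_of_affine`; the two differences are that the
fibres are open intervals and that the source representation is CONSTRUCTED here — its integrand is
`ℚ`-semialgebraic by Tarski–Seidenberg composition (`IsSemialgebraicFunOn.comp_isSemialgebraicMapOn_holds`)
and absolutely integrable by Mathlib's Jacobian criterion
`MeasureTheory.integrableOn_image_iff_integrableOn_abs_det_fderiv_smul`.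

References: M. Kontsevich, D. Zagier, *Periods* (2001), §1.2 rule (2) [KontsevichZagier2001];
J. Bochnak, M. Coste, M.-F. Roy, *Real Algebraic Geometry* (1998), §2.2 [BochnakCosteRoy1998].
-/

noncomputable section

namespace Summit.KontsevichZagierPeriods.FurushoPentagon.SectorToKernel

open Set MeasureTheory
open Literature.ModelTheory.ExponentialFields (IsSemialgebraic)
open Literature.NumberTheory.Transcendental
open Literature.NumberTheory.Transcendental.KZ

/-- **Honest pull-back along a change of variables** (rule (2) with a CONSTRUCTED source): if `Φ` is a
`ℚ`-semialgebraic map on the `ℚ`-semialgebraic `D ⊆ ℝⁿ`, injective on `D`, with derivative `Φ' x` within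
`D` at every `x ∈ D`, `r'.domain = Φ '' D`, and `J` is a `ℚ`-semialgebraic function on `D` agreeing with
`|det Φ'|` there, then the pulled-back representation `[D, (r' ∘ Φ) · J]` exists (integrand literally
`x ↦ r'.integrand (Φ x) * J x`; semialgebraic by Tarski–Seidenberg composition, integrable by the Jacobian
criterion) and `[D, (r' ∘ Φ) · J] − [r'] ∈ KZ.relations`. [cite: KontsevichZagier2001, §1.2 rule (2)] -/
theorem affineOpenBand_exists_pullback {n : ℕ} (r' : IntegralRep n) {D : Set (Fin n → ℝ)}
    (hD : IsSemialgebraic ℚ D) {Φ : (Fin n → ℝ) → (Fin n → ℝ)}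
    {Φ' : (Fin n → ℝ) → (Fin n → ℝ) →L[ℝ] (Fin n → ℝ)} (hΦ : IsSemialgebraicMapOn ℚ D Φ)
    (hderiv : ∀ x ∈ D, HasFDerivWithinAt Φ (Φ' x) D x) (hinj : InjOn Φ D)
    (himage : r'.domain = Φ '' D) {J : (Fin n → ℝ) → ℝ} (hJ : IsSemialgebraicFunOn ℚ D J)
    (hJdet : ∀ x ∈ D, |(Φ' x).det| = J x) :
    ∃ r : IntegralRep n, r.domain = D ∧ (r.integrand = fun x => r'.integrand (Φ x) * J x) ∧
      of r - of r' ∈ relations := by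
  have hmaps : MapsTo Φ D r'.domain := fun x hx => himage ▸ mem_image_of_mem Φ hx
  have hDm : MeasurableSet D :=
    Literature.ModelTheory.ExponentialFields.IsSemialgebraic.measurableSet_holds hD
  have hint : IntegrableOn (fun x => r'.integrand (Φ x) * J x) D := by
    have h0 : IntegrableOn r'.integrand (Φ '' D) := by
      rw [← himage]
      exact r'.integrableOn
    have h := (integrableOn_image_iff_integrableOn_abs_det_fderiv_smul volume hDm hderiv hinj
      r'.integrand).1 h0
    refine h.congr_fun (fun x hx => ?_) hDm
    show |(Φ' x).det| • r'.integrand (Φ x) = r'.integrand (Φ x) * J x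
    rw [smul_eq_mul, hJdet x hx, mul_comm]
  have hsa : IsSemialgebraicFunOn ℚ D (fun x => r'.integrand (Φ x) * J x) :=
    (IsSemialgebraicFunOn.mul_holds
      (IsSemialgebraicFunOn.comp_isSemialgebraicMapOn_holds r'.isSemialgebraicFunOn_integrand hΦ
        hmaps) hJ).congr fun _ _ => rfl
  refine ⟨⟨D, fun x => r'.integrand (Φ x) * J x, hD, hsa, hint⟩, rfl, rfl, ?_⟩
  refine changeOfVariablesRel_subset_relations ⟨n, _, r', Φ, Φ', hΦ, hderiv, hinj, himage,
    fun x hx => ?_, rfl⟩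
  show r'.integrand (Φ x) * J x = r'.integrand (Φ x) * |(Φ' x).det|
  rw [hJdet x hx]

/-- **B — affine straightening of an open band is a move.** Over an open `ℚ`-semialgebraic base
`G ⊆ ℝᴹ` let `α`, `β` be `ℚ`-semialgebraic and differentiable on `G` with `β > 0`.  For every representation
`r'` on the OPEN band `{(y, s) | y ∈ G, α y < s < α y + β y}` there is a representation `r` on the open
straight band `G × (0,1)` with integrand `r (y, t) = r' (y, α y + β y t) · β y` and `[r] − [r'] ∈ relations`
(rule (2) along `Φ (y, t) = (y, α y + β y t)`, Jacobian `β y` by `LinearMap.det_of_snoc_init`; integrability of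
the pulled-back integrand by `MeasureTheory.integrableOn_image_iff_integrableOn_abs_det_fderiv_smul`).
[cite: KontsevichZagier2001, §1.2 rule (2)] -/
theorem stub_affineOpenBand : ∀ {M : ℕ} {G : Set (Fin M → ℝ)}, IsOpen G → IsSemialgebraic ℚ G →
    ∀ {α β : (Fin M → ℝ) → ℝ}, IsSemialgebraicFunOn ℚ G α → IsSemialgebraicFunOn ℚ G β →
    DifferentiableOn ℝ α G → DifferentiableOn ℝ β G → (∀ y ∈ G, 0 < β y) →
    ∀ r' : IntegralRep (M + 1),
      r'.domain = {z | (Fin.init z : Fin M → ℝ) ∈ G ∧ α (Fin.init z) < z (Fin.last M) ∧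
        z (Fin.last M) < α (Fin.init z) + β (Fin.init z)} →
      ∃ r : IntegralRep (M + 1),
        r.domain = {z | (Fin.init z : Fin M → ℝ) ∈ G ∧ 0 < z (Fin.last M) ∧ z (Fin.last M) < 1} ∧
        (r.integrand = fun z => r'.integrand (Fin.snoc (Fin.init z)
          (α (Fin.init z) + β (Fin.init z) * z (Fin.last M))) * β (Fin.init z)) ∧
        of r - of r' ∈ relations := by
  intro M G hGo hG α β hα hβ hαd hβd hβpos r' hr'
  -- the open straight band `D = G × (0, 1)` (last coordinate `t`)
  set D : Set (Fin (M + 1) → ℝ) :=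
    {z | (Fin.init z : Fin M → ℝ) ∈ G ∧ 0 < z (Fin.last M) ∧ z (Fin.last M) < 1} with hD_def
  have hD : IsSemialgebraic ℚ D := by
    have h0 := Literature.ModelTheory.ExponentialFields.isSemialgebraic_setOf_eval_pos (k := ℚ)
      (R := ℝ) (MvPolynomial.X (Fin.last M) : MvPolynomial (Fin (M + 1)) ℚ)
    have h1 := Literature.ModelTheory.ExponentialFields.isSemialgebraic_setOf_eval_lt (k := ℚ)
      (R := ℝ) (MvPolynomial.X (Fin.last M) : MvPolynomial (Fin (M + 1)) ℚ) 1
    simp only [MvPolynomial.aeval_X, map_one] at h0 h1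
    convert (hG.setOf_init_mem.inter h0).inter h1 using 1
    ext z
    simp only [hD_def, mem_setOf_eq, mem_inter_iff, and_assoc]
  have hmemG : ∀ z ∈ D, Fin.init z ∈ G := fun z hz => hz.1
  have hαd' : ∀ y ∈ G, HasFDerivAt α (fderiv ℝ α y) y := fun y hy =>
    ((hαd y hy).differentiableAt (hGo.mem_nhds hy)).hasFDerivAt
  have hβd' : ∀ y ∈ G, HasFDerivAt β (fderiv ℝ β y) y := fun y hy =>
    ((hβd y hy).differentiableAt (hGo.mem_nhds hy)).hasFDerivAt
  -- the substitution (adapted from `KZ.of_sub_of_mem_relations_of_affine`)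
  set Φ : (Fin (M + 1) → ℝ) → (Fin (M + 1) → ℝ) := fun z =>
    Fin.snoc (Fin.init z) (α (Fin.init z) + β (Fin.init z) * z (Fin.last M)) with hΦ
  -- continuous linear pieces
  let initL : (Fin (M + 1) → ℝ) →L[ℝ] (Fin M → ℝ) :=
    ContinuousLinearMap.pi fun i => ContinuousLinearMap.proj (Fin.castSucc i)
  let lastL : (Fin (M + 1) → ℝ) →L[ℝ] ℝ := ContinuousLinearMap.proj (Fin.last M)
  have hinitL : ∀ w, initL w = Fin.init w := fun w => rfl
  have hlastL : ∀ w, lastL w = w (Fin.last M) := fun w => rfl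
  let row : (Fin (M + 1) → ℝ) → (Fin (M + 1) → ℝ) →L[ℝ] ℝ := fun z =>
    (fderiv ℝ α (Fin.init z)).comp initL +
      z (Fin.last M) • (fderiv ℝ β (Fin.init z)).comp initL + β (Fin.init z) • lastL
  have hrow : ∀ z w, row z w = fderiv ℝ α (Fin.init z) (Fin.init w) +
      z (Fin.last M) * fderiv ℝ β (Fin.init z) (Fin.init w) + β (Fin.init z) * w (Fin.last M) := by
    intro z w
    simp [row, hinitL, hlastL]
  let Φ' : (Fin (M + 1) → ℝ) → (Fin (M + 1) → ℝ) →L[ℝ] (Fin (M + 1) → ℝ) := fun z =>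
    ContinuousLinearMap.pi
      (Fin.lastCases (motive := fun _ => (Fin (M + 1) → ℝ) →L[ℝ] ℝ) (row z)
        (fun i => ContinuousLinearMap.proj (Fin.castSucc i)))
  have hΦ' : ∀ z w, Φ' z w = Fin.snoc (Fin.init w) (row z w) := by
    intro z w
    funext i
    refine Fin.lastCases ?_ (fun j => ?_) i
    · simp [Φ']
    · simp [Φ', Fin.init]
  -- determinant
  have hdet : ∀ z, (Φ' z).det = β (Fin.init z) := by
    intro z
    have h := LinearMap.det_of_snoc_init (Φ' z : (Fin (M + 1) → ℝ) →ₗ[ℝ] (Fin (M + 1) → ℝ))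
      LinearMap.id
      (((fderiv ℝ α (Fin.init z) : (Fin M → ℝ) →L[ℝ] ℝ) +
        z (Fin.last M) • (fderiv ℝ β (Fin.init z))) : (Fin M → ℝ) →ₗ[ℝ] ℝ)
      (β (Fin.init z)) (fun w => by
        rw [ContinuousLinearMap.coe_coe, hΦ', hrow]
        simp)
    rw [LinearMap.det_id, mul_one] at h
    exact h
  -- derivative
  have hderiv : ∀ z : Fin (M + 1) → ℝ, Fin.init z ∈ G → HasFDerivAt Φ (Φ' z) z := by
    intro z hz
    rw [hasFDerivAt_pi']
    intro i
    refine Fin.lastCases ?_ (fun j => ?_) i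
    · have h1 : HasFDerivAt (fun x : Fin (M + 1) → ℝ => Fin.init x) initL z := initL.hasFDerivAt
      have hαc := (hαd' _ hz).comp z h1
      have hβc := (hβd' _ hz).comp z h1
      have hl : HasFDerivAt (fun x : Fin (M + 1) → ℝ => x (Fin.last M)) lastL z :=
        hasFDerivAt_apply (Fin.last M) z
      have h := hαc.add (hβc.mul hl)
      have hfun : (fun x => Φ x (Fin.last M)) =
          fun x => (α ∘ fun x : Fin (M + 1) → ℝ => Fin.init x) x +
            (β ∘ fun x : Fin (M + 1) → ℝ => Fin.init x) x * x (Fin.last M) := by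
        funext x
        simp [hΦ]
      show HasFDerivAt (fun x => Φ x (Fin.last M)) _ z
      rw [hfun]
      refine h.congr_fderiv (ContinuousLinearMap.ext fun w => ?_)
      simp only [ContinuousLinearMap.coe_comp, Function.comp_apply, hΦ', hrow]
      simp [hinitL, hlastL]
      ring
    · have hfun : (fun x => Φ x (Fin.castSucc j)) = fun x => x (Fin.castSucc j) := by
        funext x
        simp [hΦ, Fin.init]
      show HasFDerivAt (fun x => Φ x (Fin.castSucc j)) _ z
      rw [hfun]
      refine (hasFDerivAt_apply (Fin.castSucc j) z).congr_fderiv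
        (ContinuousLinearMap.ext fun w => ?_)
      simp [hΦ', Fin.init]
  -- semialgebraicity of the pieces on the straight band
  have hαi : IsSemialgebraicFunOn ℚ D (fun z => α (Fin.init z)) := hα.comp_init_mono hD hmemG
  have hβi : IsSemialgebraicFunOn ℚ D (fun z => β (Fin.init z)) := hβ.comp_init_mono hD hmemG
  have hli := isSemialgebraicFunOn_apply hD (Fin.last _)
  have hΦsa : IsSemialgebraicMapOn ℚ D Φ := by
    refine (isSemialgebraicMapOn_iff_forall_holds hD).mpr fun i => ?_
    refine Fin.lastCases ?_ (fun j => ?_) i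
    · exact (IsSemialgebraicFunOn.add_holds hαi (IsSemialgebraicFunOn.mul_holds hβi hli)).congr
        fun z _ => by simp [hΦ]
    · exact (isSemialgebraicFunOn_aeval hD (MvPolynomial.X (Fin.castSucc j))).congr
        fun z _ => by simp [hΦ, Fin.init]
  -- injectivity
  have hinj : InjOn Φ D := by
    intro z₁ hz₁ z₂ hz₂ h
    have hy : Fin.init z₁ = Fin.init z₂ := by
      have := congrArg Fin.init h
      simpa [hΦ] using this
    have hl : α (Fin.init z₁) + β (Fin.init z₁) * z₁ (Fin.last M) =
        α (Fin.init z₂) + β (Fin.init z₂) * z₂ (Fin.last M) := by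
      have := congrFun h (Fin.last M)
      simpa [hΦ] using this
    rw [hy] at hl
    have hs : z₁ (Fin.last M) = z₂ (Fin.last M) :=
      mul_left_cancel₀ (hβpos _ (hmemG z₂ hz₂)).ne' (add_left_cancel hl)
    rw [← Fin.snoc_init_self z₁, ← Fin.snoc_init_self z₂, hy, hs]
  -- image: the open band
  have himage : r'.domain = Φ '' D := by
    rw [hr']
    ext w
    simp only [mem_image]
    constructor
    · intro hw
      have hy : Fin.init w ∈ G := hw.1
      have hβy := hβpos _ hy
      refine ⟨Fin.snoc (Fin.init w) ((w (Fin.last M) - α (Fin.init w)) / β (Fin.init w)), ?_, ?_⟩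
      · refine ⟨by simpa using hy, ?_, ?_⟩
        · simp only [Fin.snoc_last]
          exact div_pos (sub_pos.mpr hw.2.1) hβy
        · simp only [Fin.snoc_last]
          rw [div_lt_one hβy]
          have := hw.2.2
          linarith
      · simp only [hΦ, Fin.init_snoc, Fin.snoc_last]
        rw [mul_div_cancel₀ _ hβy.ne', add_sub_cancel, Fin.snoc_init_self]
    · rintro ⟨z, hz, rfl⟩
      have hy : Fin.init z ∈ G := hmemG z hz
      have hβy := hβpos _ hy
      have ht0 : 0 < z (Fin.last M) := hz.2.1
      have ht1 : z (Fin.last M) < 1 := hz.2.2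
      refine ⟨by simpa [hΦ] using hy, ?_, ?_⟩
      · simp only [hΦ, Fin.init_snoc, Fin.snoc_last]
        nlinarith
      · simp only [hΦ, Fin.init_snoc, Fin.snoc_last]
        nlinarith
  -- the honest pull-back along `Φ`, Jacobian `|det Φ'| = β ∘ init` on `D`
  obtain ⟨r, hrd, hri, hrel⟩ := affineOpenBand_exists_pullback r' hD hΦsa
    (fun z hz => (hderiv z (hmemG z hz)).hasFDerivWithinAt) hinj himage hβi
    (fun z hz => by rw [hdet, abs_of_pos (hβpos _ (hmemG z hz))])
  exact ⟨r, hrd, hri, hrel⟩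

end Summit.KontsevichZagierPeriods.FurushoPentagon.SectorToKernel
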